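import Literature.NumberTheory.EllipticCurves.RootNumberTableTwo
import Mathlib.Tactic.LinearCombination
import HarnessLib

/-!
# The ingredients of Kellock–Dokchitser's Notation 5.1 under `(c₄, c₆, Δ) ↦ (u⁴c₄, u⁶c₆, u¹²Δ)` — proofs

Proof file (no new definition, no new fact) serving
`Literature.NumberTheory.EllipticCurves.RootNumberTableTwoInvarianceProofs` (`W.rootNumberTwo`,
`W.rootNumberTwo'` do not depend on the Weierstrass equation).  Two Weierstrass equations over `ℚ` of
one elliptic curve have invariants related by `c₄ ↦ u⁴c₄`, `c₆ ↦ u⁶c₆`, `Δ ↦ u¹²Δ` for some `u ∈ ℚˣ`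
(Silverman, AEC III.1, Table 3.1); this file records what that rescaling does to the three ingredients
of `KellockDokchitser.w2OfInvariants` (Kellock–Dokchitser 2023, Notation 5.1: the valuations
`v₂(c₄), v₂(c₆), v₂(Δ)`, the shift `m`, and the odd parts `c₄', c₆', Δ'` read modulo `64`):

* §1 the odd part `x' = x / 2^{v₂(x)}` (`oddPart`) and its residue in `ℤ/64` lifted to `{0, …, 63}`
  (`oddRes`): `oddRes_cast` (the residue is the class `num(x')·den(x')⁻¹` in `ℤ/64` on both branches
  of the definition), `oddRes_pow_mul_cast` (`(uᵏx)' = (u')ᵏ·x'` in `ℤ/64`), `oddRes_emod_two`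
  (the residue of a non-zero rational is odd);
* §2 the arithmetic of the odd units of `ℤ/64` that makes the table blind to `u'`: for every odd
  `z ∈ ℤ/64` there is ONE `j ∈ {0, …, 7}` with `z⁴ = 1 + 16j`, `z⁶ = 1 + 24j`, `z¹² = 1 + 48j`
  (`exists_pow_eq_of_odd`, `decide` over the `32` odd residues; if `z² = 1 + 8i` these hold with
  `j = i`);
* §3 the valuations: `val2 (uᵏx) = val2 x + k·v₂(u)` (`val2_pow_mul`), and the shift absorbs a common
  multiple of `(12, 6, 4)` — `shift (v_Δ + 12t) (v₆ + 6t) (v₄ + 4t) = shift v_Δ v₆ v₄ + t` (`shift_add`) —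
  so that the reduced triple `(C_Δ, C_6, C_4) = (v₂(Δ), v₂(c₆), v₂(c₄)) − m·(12, 6, 4)` does not move
  (`map_add_map_sub`);
* §4 the package used downstream: `exists_oddRes_congr` — ONE `j ∈ ℤ` with
  `(u⁴c₄)' ≡ (1 + 16j)·c₄'`, `(u⁶c₆)' ≡ (1 + 24j)·c₆'`, `(u¹²Δ)' ≡ (1 + 48j)·Δ' (mod 64)` — and
  `map_val2_eq_top_or_oddRes_odd` (`C_4 = ⊤` or `c₄'` odd, as the table-congruence lemma wants).

Pattern.  §3 and the `num·den⁻¹` bookkeeping of §1 adapt to `p = 2` and `ℤ/64` the `p = 3`, `ℤ/9`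
lemmas `shift_add`, `pow_mul_eq_div`, `map_add_map_sub`, `natCast_mul_inv_eq_one`,
`cast_num_mul_inv_den_eq_of_eq_div` of the Summit-side files
`Summits/BirchSwinnertonDyer/BirchSwinnertonDyer/Theorems/CyclotomicUntwistRootNumberThreeInvariance.lean`
and `…/CyclotomicUntwistPSUntwistedTraceInvariance.lean` (Rizzo's `ℚ₃` table); they are re-proved here
because Literature does not import Summits and the `ℤ/64` statements are not instances of the `ℤ/9`
ones.  The folklore lemma "a rational of `2`-adic valuation `0` has odd numerator and denominator" also
exists as `Wiles2000.not_two_dvd_num_den` in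
`Literature.NumberTheory.EllipticCurves.Wiles2000CongruentProofs`; it is re-proved privately to keep the
imports of this file inside the root-number story.

## References
* [KellockDokchitser2023] L. Cowland Kellock, V. Dokchitser, *Root numbers and parity phenomena*,
  Bull. London Math. Soc. 55 (2023) = arXiv:2303.07883 — Notation 5.1 and §5, Table of `w(E/ℚ₂)`.
* [SilvermanAEC2009] J. H. Silverman, *The Arithmetic of Elliptic Curves*, 2nd ed., GTM 106, Springer
  2009 — III.1, Table 3.1 (`u⁴c₄' = c₄`, `u⁶c₆' = c₆`, `u¹²Δ' = Δ` under `x = u²x' + r`, `y = u³y' + …`).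
-/

namespace Literature.NumberTheory.EllipticCurves

namespace KellockDokchitser

/-! ## §1 The odd part and its residue in `ℤ/64` -/

section OddPart

/-- The odd part of a non-zero rational has `2`-adic valuation `0`. [cite: KellockDokchitser2023, Notation 5.1 (x')] -/
theorem padicValRat_oddPart {x : ℚ} (hx : x ≠ 0) : padicValRat 2 (oddPart x) = 0 := by
  unfold oddPart
  have h2 : (2 : ℚ) ^ padicValRat 2 x ≠ 0 := zpow_ne_zero _ (by norm_num)
  have h22 : padicValRat 2 (2 : ℚ) = 1 := by
    have := @padicValRat.self 2 (by norm_num)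
    simpa using this
  rw [div_eq_mul_inv, padicValRat.mul hx (inv_ne_zero h2), padicValRat.inv, padicValRat.zpow, h22]
  ring

/-- The odd part `x' = x/2^{v₂(x)}` of a non-zero rational is non-zero. [cite: KellockDokchitser2023, Notation 5.1 (x')] -/
theorem oddPart_ne_zero {x : ℚ} (hx : x ≠ 0) : oddPart x ≠ 0 := by
  unfold oddPart
  exact div_ne_zero hx (zpow_ne_zero _ (by norm_num))

/-- The odd part is multiplicative on non-zero rationals. [cite: KellockDokchitser2023, Notation 5.1 (x')] -/
theorem oddPart_mul {x y : ℚ} (hx : x ≠ 0) (hy : y ≠ 0) : oddPart (x * y) = oddPart x * oddPart y := by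
  unfold oddPart
  rw [padicValRat.mul hx hy, zpow_add₀ (by norm_num : (2 : ℚ) ≠ 0)]
  field_simp

/-- The odd part of a power. [folklore] -/
private theorem oddPart_pow {x : ℚ} (hx : x ≠ 0) (n : ℕ) : oddPart (x ^ n) = oddPart x ^ n := by
  induction n with
  | zero => simp [oddPart]
  | succ n ih => rw [pow_succ, oddPart_mul (pow_ne_zero _ hx) hx, ih, pow_succ]

/-- For `q ≠ 0` with `v₂(q) = 0`, numerator and denominator are odd. [folklore] -/
private theorem not_two_dvd_num_den {q : ℚ} (hq : q ≠ 0) (h : padicValRat 2 q = 0) :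
    ¬ (2 : ℤ) ∣ q.num ∧ ¬ 2 ∣ q.den := by
  haveI : Fact (Nat.Prime 2) := ⟨Nat.prime_two⟩
  have hnum0 : q.num ≠ 0 := Rat.num_ne_zero.mpr hq
  have hdef : padicValRat 2 q = padicValInt 2 q.num - padicValNat 2 q.den := rfl
  have hcop : Nat.Coprime q.num.natAbs q.den := q.reduced
  by_cases hn : (2 : ℤ) ∣ q.num
  · have hd : ¬ 2 ∣ q.den := by
      intro hd
      have h3 : 2 ∣ Nat.gcd q.num.natAbs q.den := Nat.dvd_gcd (Int.natAbs_dvd_natAbs.mpr hn) hd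
      rw [hcop] at h3
      omega
    have hvd : padicValNat 2 q.den = 0 := padicValNat.eq_zero_of_not_dvd hd
    have hvn : 1 ≤ padicValInt 2 q.num :=
      ((padicValInt_dvd_iff 1 q.num).mp (by simpa using hn)).resolve_left hnum0
    rw [hdef, hvd] at h
    push_cast at h
    omega
  · refine ⟨hn, fun hd ↦ ?_⟩
    have hvn : padicValInt 2 q.num = 0 := padicValInt.eq_zero_of_not_dvd hn
    have hvd : 1 ≤ padicValNat 2 q.den :=
      Nat.one_le_iff_ne_zero.mpr (by
        intro h0
        rw [padicValNat.eq_zero_iff] at h0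
        rcases h0 with h0 | h0 | h0
        · exact absurd h0 (by norm_num)
        · exact q.den_nz h0
        · exact h0 hd)
    rw [hdef, hvn] at h
    simp only [Nat.cast_zero, zero_sub, neg_eq_zero, Nat.cast_eq_zero] at h
    omega

/-- `((a % 64 : ℤ) : ℤ/64) = a`. [folklore] -/
private theorem intCast_emod_64 (a : ℤ) : ((a % 64 : ℤ) : ZMod 64) = (a : ZMod 64) := by
  rw [ZMod.intCast_eq_intCast_iff']
  push_cast
  exact Int.emod_emod_of_dvd a (dvd_refl 64)

/-- **`oddRes` in `ℤ/64`**: `(oddRes x : ℤ/64) = num(x') · den(x')⁻¹`, `x' = oddPart x` (both branches of the definition).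
[cite: KellockDokchitser2023, Notation 5.1] -/
theorem oddRes_cast (x : ℚ) :
    ((oddRes x : ℤ) : ZMod 64) = ((oddPart x).num : ZMod 64) * (((oddPart x).den : ZMod 64))⁻¹ := by
  unfold oddRes
  split_ifs with h
  · rw [h, intCast_emod_64]; push_cast; simp
  · push_cast
    rw [ZMod.natCast_zmod_val]

/-- `n · n⁻¹ = 1` in `ℤ/64` for odd `n`. [folklore] -/
private theorem natCast_mul_inv_eq_one {n : ℕ} (hn : ¬ 2 ∣ n) : (n : ZMod 64) * ((n : ZMod 64))⁻¹ = 1 :=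
  ZMod.coe_mul_inv_eq_one n
    (Nat.Coprime.pow_right 6 ((Nat.Prime.coprime_iff_not_dvd Nat.prime_two).mpr hn).symm)

/-- **The `ℤ/64`-residue of a `2`-integral rational from ANY quotient representation**: `q = m / n`, `n` odd ⟹
`num(q)·den(q)⁻¹ = m·n⁻¹` in `ℤ/64`. [folklore] -/
private theorem cast_num_mul_inv_den_eq_of_eq_div {q : ℚ} {m : ℤ} {n : ℕ} (hn : ¬ 2 ∣ n) (h : q = (m : ℚ) / n) :
    (q.num : ZMod 64) * ((q.den : ZMod 64))⁻¹ = (m : ZMod 64) * ((n : ZMod 64))⁻¹ := by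
  have hnz : n ≠ 0 := fun h0 ↦ hn (h0 ▸ dvd_zero 2)
  have hn0 : (n : ℚ) ≠ 0 := by exact_mod_cast hnz
  have hq : (q.num : ℚ) / q.den = (m : ℚ) / n := by rw [Rat.num_div_den]; exact h
  have hden0 : (q.den : ℚ) ≠ 0 := by exact_mod_cast q.den_nz
  have hZ : q.num * n = m * q.den := by
    have := (div_eq_div_iff hden0 hn0).mp hq
    exact_mod_cast this
  have hdq : ¬ 2 ∣ q.den := by
    intro hd
    have h3 : (2 : ℤ) ∣ q.num * n := hZ ▸ dvd_mul_of_dvd_right (by exact_mod_cast hd) m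
    rcases Int.prime_two.dvd_or_dvd h3 with h | h
    · have hg : 2 ∣ Nat.gcd q.num.natAbs q.den :=
        Nat.dvd_gcd (by exact_mod_cast Int.natAbs_dvd_natAbs.mpr h) hd
      rw [q.reduced] at hg
      omega
    · exact hn (by exact_mod_cast h)
  have h1 := natCast_mul_inv_eq_one hn
  have h2 := natCast_mul_inv_eq_one hdq
  have hZ' : (q.num : ZMod 64) * (n : ZMod 64) = (m : ZMod 64) * (q.den : ZMod 64) := by
    exact_mod_cast congrArg (Int.cast : ℤ → ZMod 64) hZ
  linear_combination (((q.den : ZMod 64))⁻¹ * ((n : ZMod 64))⁻¹) * hZ' - (q.num : ZMod 64) * ((q.den : ZMod 64))⁻¹ * h1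
    + (m : ZMod 64) * ((n : ZMod 64))⁻¹ * h2

/-- `Pᵏ·Q = (num Pᵏ · num Q) / (den Pᵏ · den Q)`. [folklore] -/
private theorem pow_mul_eq_div (P Q : ℚ) (k : ℕ) :
    P ^ k * Q = (((P.num ^ k * Q.num : ℤ)) : ℚ) / (((P.den ^ k * Q.den : ℕ)) : ℚ) := by
  have hP : (P.den : ℚ) ≠ 0 := by exact_mod_cast P.den_nz
  have hQ : (Q.den : ℚ) ≠ 0 := by exact_mod_cast Q.den_nz
  conv_lhs => rw [← Rat.num_div_den P, ← Rat.num_div_den Q]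
  push_cast
  rw [div_pow]
  field_simp

/-- Inverses of units in `ℤ/64` are unique: `A·X = 1 = A·Y ⟹ X = Y`. [folklore] -/
private theorem inv_unique {A X Y : ZMod 64} (hX : A * X = 1) (hY : A * Y = 1) : X = Y := by
  linear_combination (-X) * hY + Y * hX

/-- **`oddRes (uᵏ·x) = zᵏ · oddRes x` in `ℤ/64`** for `x, u ≠ 0`, where `z = num(u')·den(u')⁻¹` is the residue of the odd
part of `u`. [cite: KellockDokchitser2023, Notation 5.1] -/
theorem oddRes_pow_mul_cast {u x : ℚ} (hu : u ≠ 0) (hx : x ≠ 0) (k : ℕ) :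
    ((oddRes (u ^ k * x) : ℤ) : ZMod 64) =
      (((oddPart u).num : ZMod 64) * (((oddPart u).den : ZMod 64))⁻¹) ^ k * ((oddRes x : ℤ) : ZMod 64) := by
  set P := oddPart u with hP
  set Q := oddPart x with hQ
  have hP0 : P ≠ 0 := oddPart_ne_zero hu
  have hQ0 : Q ≠ 0 := oddPart_ne_zero hx
  obtain ⟨-, hPd⟩ := not_two_dvd_num_den hP0 (padicValRat_oddPart hu)
  obtain ⟨-, hQd⟩ := not_two_dvd_num_den hQ0 (padicValRat_oddPart hx)
  have hR : oddPart (u ^ k * x) = P ^ k * Q := by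
    rw [oddPart_mul (pow_ne_zero _ hu) hx, oddPart_pow hu]
  have hn : ¬ 2 ∣ P.den ^ k * Q.den := by
    intro h
    rcases (Nat.Prime.dvd_mul Nat.prime_two).mp h with h | h
    · exact hPd (Nat.prime_two.dvd_of_dvd_pow h)
    · exact hQd h
  rw [oddRes_cast, oddRes_cast, cast_num_mul_inv_den_eq_of_eq_div hn (hR.trans (pow_mul_eq_div P Q k))]
  -- `((den P)^k den Q)⁻¹ = (den P⁻¹)^k (den Q)⁻¹`
  have hA := natCast_mul_inv_eq_one hn
  have hB : ((P.den ^ k * Q.den : ℕ) : ZMod 64) * ((((P.den : ZMod 64))⁻¹) ^ k * ((Q.den : ZMod 64))⁻¹) = 1 := by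
    have h1 := natCast_mul_inv_eq_one hPd
    have h2 := natCast_mul_inv_eq_one hQd
    push_cast
    calc ((P.den : ZMod 64)) ^ k * (Q.den : ZMod 64) * ((((P.den : ZMod 64))⁻¹) ^ k * ((Q.den : ZMod 64))⁻¹)
        = ((P.den : ZMod 64) * ((P.den : ZMod 64))⁻¹) ^ k * ((Q.den : ZMod 64) * ((Q.den : ZMod 64))⁻¹) := by ring
      _ = 1 := by rw [h1, h2, one_pow, one_mul]
  rw [inv_unique hA hB]
  push_cast
  ring

/-- `oddRes x` is odd for `x ≠ 0`: the odd part `x'` is a `2`-adic unit, so its class in `ℤ/64` is a unit.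
[cite: KellockDokchitser2023, Notation 5.1 (x')] -/
theorem oddRes_emod_two {x : ℚ} (hx : x ≠ 0) : oddRes x % 2 = 1 := by
  set Q := oddPart x with hQ
  have hQ0 : Q ≠ 0 := oddPart_ne_zero hx
  obtain ⟨hQn, hQd⟩ := not_two_dvd_num_den hQ0 (padicValRat_oddPart hx)
  have hcast := oddRes_cast x
  have hD := natCast_mul_inv_eq_one hQd
  -- descend to `ℤ/2`
  have hc2 := congrArg (ZMod.castHom (show 2 ∣ 64 by norm_num) (ZMod 2)) hcast
  have hD2 := congrArg (ZMod.castHom (show 2 ∣ 64 by norm_num) (ZMod 2)) hD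
  simp only [map_mul, map_intCast, map_natCast, map_one] at hc2 hD2
  have hden : ((Q.den : ZMod 2)) = 1 := by
    have : ((Q.den : ZMod 2)) ≠ 0 := by rw [Ne, ZMod.natCast_eq_zero_iff]; exact_mod_cast hQd
    revert this; generalize ((Q.den : ZMod 2)) = z; decide +revert
  have hnum : ((Q.num : ZMod 2)) = 1 := by
    have : ((Q.num : ZMod 2)) ≠ 0 := by rw [Ne, ZMod.intCast_zmod_eq_zero_iff_dvd]; exact_mod_cast hQn
    revert this; generalize ((Q.num : ZMod 2)) = z; decide +revert
  rw [hden, one_mul] at hD2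
  rw [hnum, hD2, mul_one] at hc2
  have := (ZMod.intCast_eq_intCast_iff' (oddRes x) 1 2).mp (by simpa using hc2)
  omega

end OddPart

/-! ## §2 Odd units of `ℤ/64`: `z⁴ = 1 + 16j`, `z⁶ = 1 + 24j`, `z¹² = 1 + 48j` -/

section Units

/-- For an odd `z ∈ ℤ/64` (`z² = 1 + 8j`): `z⁴ = 1 + 16j`, `z⁶ = 1 + 24j`, `z¹² = 1 + 48j` for one `j ∈ {0,…,7}`. [folklore] -/
private theorem exists_pow_eq_of_odd : ∀ z : ZMod 64, z.val % 2 = 1 →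
    ∃ j : Fin 8, z ^ 4 = 1 + 16 * ((j : ℕ) : ZMod 64) ∧ z ^ 6 = 1 + 24 * ((j : ℕ) : ZMod 64) ∧
      z ^ 12 = 1 + 48 * ((j : ℕ) : ZMod 64) := by
  decide

/-- A product `m · n⁻¹` of odd residues is odd in `ℤ/64`. [folklore] -/
private theorem val_emod_two_of_odd {m : ℤ} {n : ℕ} (hm : ¬ (2 : ℤ) ∣ m) (hn : ¬ 2 ∣ n) :
    ((m : ZMod 64) * ((n : ZMod 64))⁻¹).val % 2 = 1 := by
  have hD := natCast_mul_inv_eq_one hn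
  set z := (m : ZMod 64) * ((n : ZMod 64))⁻¹ with hz
  have hz2 : ZMod.castHom (show 2 ∣ 64 by norm_num) (ZMod 2) z = 1 := by
    have hD2 := congrArg (ZMod.castHom (show 2 ∣ 64 by norm_num) (ZMod 2)) hD
    simp only [map_mul, map_natCast, map_one] at hD2
    have hden : ((n : ZMod 2)) = 1 := by
      have : ((n : ZMod 2)) ≠ 0 := by rw [Ne, ZMod.natCast_eq_zero_iff]; exact_mod_cast hn
      revert this; generalize ((n : ZMod 2)) = w; decide +revert
    have hnum : ((m : ZMod 2)) = 1 := by
      have : ((m : ZMod 2)) ≠ 0 := by rw [Ne, ZMod.intCast_zmod_eq_zero_iff_dvd]; exact_mod_cast hm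
      revert this; generalize ((m : ZMod 2)) = w; decide +revert
    rw [hden, one_mul] at hD2
    rw [hz, map_mul, map_intCast, hnum, hD2, mul_one]
  have hval : (z.val : ZMod 2) = 1 := by
    rw [← hz2, ← ZMod.natCast_zmod_val z, map_natCast, ZMod.natCast_zmod_val]
  have := (ZMod.natCast_eq_natCast_iff' z.val 1 2).mp (by simpa using hval)
  omega

end Units

/-! ## §3 Valuations and the shift under rescaling -/

section Shift

/-- **The shift absorbs a common multiple of `(12, 6, 4)`**: `shift (vΔ + 12t) (v₆ + 6t) (v₄ + 4t) = shift vΔ v₆ v₄ + t`.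
[cite: KellockDokchitser2023, Notation 5.1] -/
theorem shift_add (vΔ : ℤ) (v6 v4 : WithTop ℤ) (t : ℤ) :
    shift (vΔ + 12 * t) (v6.map fun n => n + 6 * t) (v4.map fun n => n + 4 * t) = shift vΔ v6 v4 + t := by
  unfold shift
  have hΔ : (vΔ + 12 * t) / 12 = vΔ / 12 + t := by omega
  cases v6 with
  | top =>
    cases v4 with
    | top => simp [hΔ]
    | coe n4 =>
      simp only [WithTop.map_top, WithTop.map_coe, hΔ]
      have : (n4 + 4 * t) / 4 = n4 / 4 + t := by omega
      rw [this, min_add_add_right]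
  | coe n6 =>
    have h6 : (n6 + 6 * t) / 6 = n6 / 6 + t := by omega
    cases v4 with
    | top => simp only [WithTop.map_top, WithTop.map_coe, hΔ, h6, min_add_add_right]
    | coe n4 =>
      simp only [WithTop.map_coe, hΔ, h6]
      have : (n4 + 4 * t) / 4 = n4 / 4 + t := by omega
      rw [this, min_add_add_right, min_add_add_right]

/-- `val2 (uᵏ·x) = val2 x + k·v₂(u)`. [cite: KellockDokchitser2023, Notation 5.1] -/
theorem val2_pow_mul {u x : ℚ} (hu : u ≠ 0) (k : ℕ) :
    val2 (u ^ k * x) = (val2 x).map fun n => n + k * padicValRat 2 u := by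
  unfold val2
  by_cases hx : x = 0
  · simp [hx]
  · have hux : u ^ k * x ≠ 0 := mul_ne_zero (pow_ne_zero _ hu) hx
    simp only [hux, hx, if_false, WithTop.map_coe]
    rw [padicValRat.mul (pow_ne_zero _ hu) hx, padicValRat.pow]
    push_cast
    exact add_comm _ _

/-- The reduced valuations `C_6 = v₂(c₆) − 6m`, `C_4 = v₂(c₄) − 4m` are unchanged when the valuation moves by
`k t` and the shift by `t`: `(v + k t) − k (m + t) = v − k m` under `WithTop.map`. [cite: KellockDokchitser2023, Notation 5.1] -/
theorem map_add_map_sub (v : WithTop ℤ) (k t m : ℤ) :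
    ((v.map fun n => n + k * t).map fun n => n - k * (m + t)) = v.map fun n => n - k * m := by
  cases v with
  | top => rfl
  | coe n =>
    simp only [WithTop.map_coe]
    congr 1
    ring

end Shift

/-! ## §4 One `j` for the three odd parts -/

section Congr

/-- **One odd unit of `ℤ/64` governs all three odd parts.**  For `u ∈ ℚˣ` let `z ∈ (ℤ/64)ˣ` be the
class of its odd part `u'`; with the `j` of `exists_pow_eq_of_odd` (`z⁴ = 1 + 16j`, `z⁶ = 1 + 24j`,
`z¹² = 1 + 48j`) the residues fed to the table satisfy `(u⁴c₄)' ≡ (1 + 16j)·c₄'`,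
`(u⁶c₆)' ≡ (1 + 24j)·c₆'`, `(u¹²Δ)' ≡ (1 + 48j)·Δ' (mod 64)` (also when an invariant vanishes).
[cite: KellockDokchitser2023, Notation 5.1] -/
theorem exists_oddRes_congr {u : ℚ} (hu : u ≠ 0) (c₄ c₆ Δ : ℚ) :
    ∃ j : ℤ, oddRes (u ^ 4 * c₄) ≡ (1 + 16 * j) * oddRes c₄ [ZMOD 64] ∧
      oddRes (u ^ 6 * c₆) ≡ (1 + 24 * j) * oddRes c₆ [ZMOD 64] ∧
      oddRes (u ^ 12 * Δ) ≡ (1 + 48 * j) * oddRes Δ [ZMOD 64] := by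
  obtain ⟨hn, hd⟩ := not_two_dvd_num_den (oddPart_ne_zero hu) (padicValRat_oddPart hu)
  obtain ⟨j, h4, h6, h12⟩ := exists_pow_eq_of_odd _ (val_emod_two_of_odd hn hd)
  have key : ∀ (k : ℕ) (c : ℤ) (x : ℚ),
      (((oddPart u).num : ZMod 64) * (((oddPart u).den : ZMod 64))⁻¹) ^ k
          = 1 + (c : ZMod 64) * ((j : ℕ) : ZMod 64) →
        oddRes (u ^ k * x) ≡ (1 + c * ((j : ℕ) : ℤ)) * oddRes x [ZMOD 64] := by
    intro k c x hk
    apply (ZMod.intCast_eq_intCast_iff _ _ 64).mp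
    by_cases hx : x = 0
    · subst hx
      simp [oddRes, oddPart]
    · rw [oddRes_pow_mul_cast hu hx k, hk]
      push_cast
      ring
  exact ⟨(j : ℕ), key 4 16 c₄ (by rw [h4]; push_cast; ring), key 6 24 c₆ (by rw [h6]; push_cast; ring),
    key 12 48 Δ (by rw [h12]; push_cast; ring)⟩

/-- The hypothesis `C_4 = ⊤ ∨ c₄' odd` of `w2Table_congr_of_oddUnit` on actual invariants: `c₄ = 0` gives
`val2 c₄ = ⊤`, otherwise the odd part has an odd residue. [cite: KellockDokchitser2023, Notation 5.1] -/
theorem map_val2_eq_top_or_oddRes_odd (x : ℚ) (f : ℤ → ℤ) : (val2 x).map f = ⊤ ∨ oddRes x % 2 = 1 := by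
  by_cases hx : x = 0
  · left
    simp [hx, val2]
  · exact Or.inr (oddRes_emod_two hx)

end Congr

end KellockDokchitser

end Literature.NumberTheory.EllipticCurves
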